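import Summits.PneNP.PneNP.Theorems.SoloBlindEquivalentForms
import Literature.Computability.MetaComplexity.DistProblemsProofs
import HarnessLib

/-!
# Solo (blind) — corridor map, part 3: the average-case entrance (Impagliazzo's worlds)

Corridor-map calibration for the accompanying document (`paper/sharpest-statement.md`, §0/§K).
The average-case corridor enters the summit through the trivial inclusion of Impagliazzo's
"Algorithmica" in "Heuristica": if `NP ⊆ P` then every distributional `NP` problem is solved
exactly, hence errorlessly on average under EVERY ensemble.  So any average-case lower bound
for `NP` — `DistNP ⊄ AvgP`, `DistNP ⊄ HeurP`, or one `NP` language hard on average under the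
uniform ensemble — proves `PneNP`.  All bridges are assembled from PROVED tree theorems
(`distClass_P_subset_AvgP_holds`, `AvgP_subset_HeurP_holds`, `uniformEnsemble_mem_PSamp_holds`);
the open inputs are the hypotheses.  (The converse, `PneNP → DistNP ⊄ AvgP`, is the
worst-case-to-average-case problem for `NP` and is NOT claimed.)

* `SoloBlind.DistNP_subset_AvgP_of_not_pneNP : ¬PneNP → DistNP ⊆ AvgP`;
* `SoloBlind.pneNP_of_not_DistNP_subset_AvgP`, `SoloBlind.pneNP_of_not_DistNP_subset_HeurP`;
* `SoloBlind.pneNP_of_hard_on_average_uniform : (∃ L ∈ NP, ⟨L, U⟩ ∉ HeurP) → PneNP`.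

References: R. Impagliazzo, *A personal view of average-case complexity*, SCT 1995, §2;
A. Bogdanov, L. Trevisan, *Average-case complexity*, Found. Trends TCS 2(1) (2006), §2.1–2.2;
L. Levin, SIAM J. Comput. 15 (1986).
-/

namespace Summit.PneNP.PneNP.Theorems

open Literature.Computability.Complexity Literature.Computability.MetaComplexity

/-- **Algorithmica ⊆ Heuristica**: under the negated summit `NP ⊆ P`, so
`DistNP = (NP, PSamp) ⊆ (P, all ensembles) ⊆ AvgP`. [Impagliazzo 1995, §2; Bogdanov–Trevisan 2006, §2.1] -/
theorem SoloBlind.DistNP_subset_AvgP_of_not_pneNP (h : ¬ PneNP) : DistNP ⊆ AvgP := by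
  have hNP : Nondeterministic.NP ⊆ Classes.P := by
    by_contra hn
    exact h (SoloBlind.pneNP_iff_not_NP_subset_P.2 hn)
  exact (distClass_mono hNP (Set.subset_univ _)).trans distClass_P_subset_AvgP_holds

/-- **Average-case hardness of `NP` proves the summit (errorless form)**: `DistNP ⊄ AvgP → PneNP`.
[Impagliazzo 1995, §2; Bogdanov–Trevisan 2006, §2.2] -/
theorem SoloBlind.pneNP_of_not_DistNP_subset_AvgP (h : ¬ DistNP ⊆ AvgP) : PneNP := by
  by_contra hn
  exact h (SoloBlind.DistNP_subset_AvgP_of_not_pneNP hn)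

/-- **Average-case hardness of `NP` proves the summit (heuristic form)**: `DistNP ⊄ HeurP → PneNP`
(`AvgP ⊆ HeurP`). [Impagliazzo 1995, §2; Bogdanov–Trevisan 2006, §2.2] -/
theorem SoloBlind.pneNP_of_not_DistNP_subset_HeurP (h : ¬ DistNP ⊆ HeurP) : PneNP := by
  by_contra hn
  exact h ((SoloBlind.DistNP_subset_AvgP_of_not_pneNP hn).trans AvgP_subset_HeurP_holds)

/-- **One `NP` language hard on average under the uniform ensemble proves the summit**: if some
`L ∈ NP` has no heuristic scheme under `U = (Uₙ)`, then `PneNP` (the uniform ensemble is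
samplable, `uniformEnsemble_mem_PSamp_holds`). [Levin 1986; Bogdanov–Trevisan 2006, §2.1–2.2] -/
theorem SoloBlind.pneNP_of_hard_on_average_uniform
    (h : ∃ L ∈ Nondeterministic.NP, (⟨L, uniformEnsemble⟩ : DistProblem) ∉ HeurP) : PneNP := by
  obtain ⟨L, hL, hLU⟩ := h
  apply SoloBlind.pneNP_of_not_DistNP_subset_HeurP
  intro hsub
  exact hLU (hsub ⟨hL, uniformEnsemble_mem_PSamp_holds⟩)

end Summit.PneNP.PneNP.Theorems
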